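import Mathlib
import HarnessLib
import Summits.CriticalPhenomena.Ising3DConformalLimit.Theses.FourToThreeSlab

/-!
# Birth skeleton (BC3) for crux `SlabGaussianWindow` (item stmt-CriticalPhenomena-4814)
# of route `FourToThreeSlab`, sub-problem `Ising3DConformalLimit`

Line `birth` (skeleton registrar, 2026-08-17). The crux: for every continuous compactly supported
`f ≠ 0` the kurtosis `⟨T⁴⟩/⟨T²⟩²` of the zero-Matsubara-mode block field
`T_(f,M) = Σ_((x,k) ∈ ℤ³×ℤ_M) f(x/M) σ_(x,k)` in the critical plus state of the slab `ℤ³ × ℤ_M`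
(`β = β_c(M)`, `h = 0`) tends to `3` as `M → ∞`.

The cut (the route's own mechanism — Aizenman–Duminil-Copin marginal triviality transported to the
slab at the compactification scale — made quantitative against ONE reference normalisation, the
critical slab block variance `Σ_M`):

* `stub_zeroModeWickDeviation` (load-bearing, XL): the fourth-moment Wick deviation of `T_(f,M)` is
  `≤ C ‖f‖_∞⁴ r^γ (log M)^(-c) Σ_M²` (ADC 2021 Prop. 1.4 / §6.3 shape, on `ℤ³ × ℤ_M` at `β_c(M)`);
* `stub_blockVariance_pos` (M): `0 < Σ_M` (thermodynamic limit by GKS + Griffiths I);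
* `stub_zeroModeVarianceNondegenerate` (L/XL): `⟨T_(f,M)²⟩ ≥ κ_f Σ_M` eventually, for SIGNED `f ≠ 0`
  (the variance floor the kurtosis needs and ADC's normalised theorem does not contain).

Composition `SlabGaussianWindow_of : __Registered.stub_zeroModeWickDeviation →
__Registered.stub_blockVariance_pos → __Registered.stub_zeroModeVarianceNondegenerate →
Theses.FourToThreeSlab.SlabGaussianWindow` is a real proof (no `sorry`, axioms ⊆ {propext,
Classical.choice, Quot.sound}): `|kurt − 3| = |⟨T⁴⟩ − 3⟨T²⟩²| / ⟨T²⟩² ≤ K_f (log M)^(-c) → 0`.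
`__Registered.stub_x := type_of% stub_x` names each stub's statement, so the composition's
hypotheses are the declared stubs BY NAME; the closing `example` instantiates it with the three
`stub_*` constants (the no-hypothesis shape, `sorry` only via the stubs).

Disproof used: no `Disproof.lean` exists for this crux (`ledger crux ls`: no workfiles, 2026-08-17);
`ledger negatives --problem CriticalPhenomena`: nothing in this sub-problem resembles a stub.
-/

noncomputable section

namespace Summit.CriticalPhenomena.Ising3DConformalLimit.Cruxes.SlabGaussianWindow.Birth

open Literature.Probability.LatticeModels Filter Topology

/-! ### Reducible shorthands for the slab objects INLINED in the crux

All five are `abbrev`s (reducible): every statement below unfolds, definitionally, to the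
vocabulary of the route file (`isingExpect`, `zdGraph 3 □ torusGraph 1 M`, `box 3 L ×ˢ univ`,
`limUnder`, `sInf`, `finsum`, `spinAt`); the closing `example` of this section records that the
abbreviated kurtosis statement is the crux `SlabGaussianWindow` by `Iff.rfl`. -/

/-- The plus state of the slab `ℤ³ × ℤ_M` at inverse temperature `β`, `h = 0`: the `L → ∞` limit
(`limUnder`, genuine by GKS box-monotonicity for the even observables used here) of the plus-b.c.
Gibbs expectations in the volumes `box 3 L ×ˢ univ` — verbatim the crux's inlined state. -/
abbrev slabPlus (M : ℕ) [NeZero M] (β : ℝ) (F : SpinConfig (Site 3 × TorusSite 1 M) → ℝ) : ℝ :=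
  limUnder atTop (fun L : ℕ =>
    isingExpect (zdGraph 3 □ torusGraph 1 M) (box 3 L ×ˢ Finset.univ) β 0 BoundaryCondition.plus F)

/-- The slab critical point `β_c(M) := inf {β ≥ 0 : ⟨σ_(0,0)⟩⁺_β > 0}` — verbatim the crux's `sInf`. -/
abbrev slabCriticalBeta (M : ℕ) [NeZero M] : ℝ :=
  sInf {β : ℝ | 0 ≤ β ∧ 0 < slabPlus M β (spinAt (0, 0))}

/-- The zero-Matsubara-mode block field `T_(f,M)(σ) = Σ_((x,k) ∈ ℤ³×ℤ_M) f(x/M) σ_(x,k)`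
(a finite sum for compactly supported `f`) — verbatim the crux's `finsum`. -/
abbrev zeroMode (M : ℕ) (f : EuclideanSpace ℝ (Fin 3) → ℝ)
    (σ : SpinConfig (Site 3 × TorusSite 1 M)) : ℝ :=
  ∑ᶠ p : Site 3 × TorusSite 1 M, f (WithLp.toLp 2 fun i => ((p.1 i : ℤ) : ℝ) / (M : ℝ)) * spinAt p σ

/-- `⟨T_(f,M)ⁿ⟩⁺_(β_c(M))`, the `n`-th moment of the zero mode in the critical slab plus state. -/
abbrev zeroModeMoment (M : ℕ) [NeZero M] (f : EuclideanSpace ℝ (Fin 3) → ℝ) (n : ℕ) : ℝ :=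
  slabPlus M (slabCriticalBeta M) (fun σ => zeroMode M f σ ^ n)

/-- `Σ_M := ⟨(Σ_(p ∈ Λ_M × ℤ_M) σ_p)²⟩⁺_(β_c(M))`, the critical slab BLOCK VARIANCE at the
compactification scale (`Λ_M = box 3 M = [-M, M]³ ∩ ℤ³`, the whole ring): the reference
normalisation `Σ_L` of Aizenman–Duminil-Copin 2021, §1.2 (there `⟨(Σ_(Λ_L) σ_x)²⟩` on `ℤ⁴`),
transported to the slab at `L = M`. [cite: AizenmanDuminilCopinAnnals2021, §1.2 (Σ_L)] -/
abbrev blockVariance (M : ℕ) [NeZero M] : ℝ :=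
  slabPlus M (slabCriticalBeta M) (fun σ => (∑ p ∈ box 3 M ×ˢ Finset.univ, spinAt p σ) ^ 2)

/-- The abbreviated kurtosis statement is the route decl `SlabGaussianWindow`, definitionally. -/
example : (∀ (f : EuclideanSpace ℝ (Fin 3) → ℝ), Continuous f → HasCompactSupport f → f ≠ 0 →
    ∀ ε : ℝ, 0 < ε → ∃ M₀ : ℕ, ∀ (M : ℕ) [NeZero M], M₀ ≤ M →
      |zeroModeMoment M f 4 / zeroModeMoment M f 2 ^ 2 - 3| < ε) ↔
    Summit.CriticalPhenomena.Ising3DConformalLimit.Theses.FourToThreeSlab.SlabGaussianWindow :=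
  Iff.rfl

/-! ### The stubs -/

/-- **STUB A (load-bearing) — `stub_zeroModeWickDeviation`: Aizenman–Duminil-Copin's `d = 4`
marginal-triviality estimate transported to the critical slab at the compactification scale.**
There are `c, C, γ > 0`-type constants (`c > 0`, `C > 0`, `γ` real) such that for every continuous
`f` vanishing outside the cube `[-r, r]³` (`r ≥ 1`) and every ring size `M ≥ 2`, the deviation of
the fourth moment of the zero mode `T_(f,M)` from Wick's law in the critical plus state of
`ℤ³ × ℤ_M` is small RELATIVE TO THE SQUARED BLOCK VARIANCE `Σ_M²`:
`|⟨T⁴⟩ − 3⟨T²⟩²| ≤ C ‖f‖_∞⁴ r^γ (log M)^(-c) Σ_M²`.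
This is the slab transcription of ADC 2021, Proposition 1.4 in the form its §6.3 proves it
(fourth-moment Wick deviation `≤ ‖f‖_∞⁴ S(L, r, β)`, `S(L,r,β) = Σ_(Λ_(rL)⁴) |U₄| ≤ C r¹² (log L)^(-c) Σ_L²`,
from the improved tree diagram bound Thm 1.3 and the sliding-scale infrared bound Thm 5.6; on `ℤ⁴`
the tree's named fact `Literature.Probability.LatticeModels.aizenmanDuminilCopin_ursellFourSum_le`),
with `L := M`, `ℤ⁴` replaced by `ℤ³ × ℤ_M` and `β_c(ℤ⁴)` by the slab's own `β_c(M)`; `γ` is left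
existential (the slab site count differs from `r¹²`). Valid for signed `f` (the identity
`⟨T⁴⟩ − 3⟨T²⟩² = Σ f⊗⁴ U₄` is algebra). Why plausibly true: up to scale `M` the slab is
4D-critical (currents rarely intersect, bubble `B_M ≍ log M`), and beyond scale `M` the effective
3D quartic coupling is `u(L) ≍ (L/M)/log M`, whence the polynomial loss in `r`. Why it might fail:
exactly the crux's recorded risk — ADC's `(log)^(-c)` gain (regular scales, sliding-scale IRB,
intersection mixing) must be redone on `ℤ³ × ℤ_M` at `β_c(M) > β_c(ℤ⁴)` with currents winding
round the ring, and the 3D scales `≳ M` must contribute only `O(r^γ / log M)`. Size: XL.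
[cite: AizenmanDuminilCopinAnnals2021, Prop. 1.4, §6.3, Thm 1.3, Thm 5.6]
[cite: DuminilCopinPanis2025LowerBounds, Thm 1.4 and 1.8 (arXiv:2404.05700)] -/
theorem stub_zeroModeWickDeviation :
    ∃ c C γ : ℝ, 0 < c ∧ 0 < C ∧
      ∀ (f : EuclideanSpace ℝ (Fin 3) → ℝ), Continuous f →
      ∀ r : ℝ, 1 ≤ r → (∀ x, f x ≠ 0 → ∀ i, |x i| ≤ r) →
      ∀ (M : ℕ) [NeZero M], 2 ≤ M →
        |zeroModeMoment M f 4 - 3 * zeroModeMoment M f 2 ^ 2| ≤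
          C * (⨆ x, |f x|) ^ 4 * r ^ γ / Real.log M ^ c * blockVariance M ^ 2 := by
  sorry

/-- **STUB B — `stub_blockVariance_pos`: well-posedness of the reference normalisation.** For every
ring size `M ≥ 1` the critical slab block variance is positive: `0 < Σ_M`. Content: the plus-state
thermodynamic limit `L → ∞` of the even observable `(Σ_(Λ_M×ℤ_M) σ)²` EXISTS on the slab graph
(GKS II: plus-b.c. correlations decrease in the volume), so the `limUnder` is a genuine limit, and
it is `≥ |Λ_M × ℤ_M| ≥ 1` by Griffiths' first inequality and `σ_p² = 1`. Why it might fail: it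
does not mathematically; formally it needs GKS volume-monotonicity for `isingExpect` on the
box-product graph `zdGraph 3 □ torusGraph 1 M` (in the tree for `ℤ^d` boxes; to be transported).
Size: M (provable now). [cite: FriedliVelenik2017, §3.6–3.8 (GKS, thermodynamic limit of ⟨·⟩⁺)]
[cite: GriffithsSimon1973] -/
theorem stub_blockVariance_pos :
    ∀ (M : ℕ) [NeZero M], 0 < blockVariance M := by
  sorry

/-- **STUB C — `stub_zeroModeVarianceNondegenerate`: non-degeneracy of the zero-mode covariance for
SIGNED test functions.** For every continuous compactly supported `f ≠ 0` there are `κ_f > 0` and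
`M₀` such that `⟨T_(f,M)²⟩⁺_(β_c(M)) ≥ κ_f Σ_M` for all `M ≥ M₀`: the variance of the zero mode is
comparable to the block variance at the same scale, with NO cancellation catastrophe for
sign-changing `f`. This is the part of the crux that ADC's theorem does not contain (ADC normalise
`T_(f,L)` by `Σ_L^(1/2)` and allow degenerate Gaussian limits; the KURTOSIS needs a variance floor):
heuristically `⟨T_(f,M)²⟩ / Σ_M → Q(f)/Q(𝟙_([-1,1]³))` with `Q(f) = ∫∫ f(y) f(y') |y − y'|⁻¹ dy dy'`
`= c ∫ |f̂(k)|² |k|⁻² dk > 0`, the positive-definite 3D Coulomb form of the ring-integrated 4D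
kernel (the covariance the route header says the Gaussian limit is "forced to be"). For `f ≥ 0` it
reduces to a doubling estimate `Σ_(ρM) ≳_ρ Σ_(rM)` for the block variance. Why it might fail: it
needs two-point regularity at scale `M` on the slab at `β_c(M)` (a scaling form of
`Σ_(k,k') ⟨σ_(x,k)σ_(y,k')⟩` for `|x − y| ≍ M`) finer than what is known even on `ℤ⁴`, where
`G(x) ≍ |x|⁻²` holds only up to a logarithm (Duminil-Copin–Panis 2024, Thm 1.4); a sign-changing
`f` whose `Q(f)` is anomalously small is the adversary. Size: L/XL.
[cite: DuminilCopinPanis2025LowerBounds, Thm 1.4 (arXiv:2404.05700)]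
[cite: AizenmanDuminilCopinAnnals2021, §1.2 (normalisation by Σ_L) and Thm 1.2]
[cite: Newman1975Gaussian] -/
theorem stub_zeroModeVarianceNondegenerate :
    ∀ (f : EuclideanSpace ℝ (Fin 3) → ℝ), Continuous f → HasCompactSupport f → f ≠ 0 →
      ∃ κ : ℝ, 0 < κ ∧ ∃ M₀ : ℕ, ∀ (M : ℕ) [NeZero M], M₀ ≤ M →
        κ * blockVariance M ≤ zeroModeMoment M f 2 := by
  sorry

/-! ### The composition (sorry-free): the three stub STATEMENTS give the crux -/

/-- **The crux statement from the three stub statements** (hypotheses = the statements of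
`stub_zeroModeWickDeviation`, `stub_blockVariance_pos`, `stub_zeroModeVarianceNondegenerate`,
verbatim; conclusion = the definiens of `SlabGaussianWindow`; real proof, no `sorry`).
Given `f ≠ 0` and `ε > 0`: pick a box radius `r ≥ 1` for the compact support; STUB C gives
`κ, M₀`; since `c > 0`, `(log M)^c → ∞`, so for `M ≥ M₁` one has
`K/ε < (log M)^c` with `K := C ‖f‖_∞⁴ r^γ / κ²`; for `M ≥ max(M₀, M₁, 2)`:
`|⟨T⁴⟩/⟨T²⟩² − 3| = |⟨T⁴⟩ − 3⟨T²⟩²| / ⟨T²⟩² ≤ (K/(log M)^c) (κΣ_M)²/⟨T²⟩² ≤ K/(log M)^c < ε`,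
using `0 < κ Σ_M ≤ ⟨T²⟩` (STUBS B, C) and STUB A. -/
theorem slabGaussianWindow_of_hyps
    (hA : ∃ c C γ : ℝ, 0 < c ∧ 0 < C ∧
      ∀ (f : EuclideanSpace ℝ (Fin 3) → ℝ), Continuous f →
      ∀ r : ℝ, 1 ≤ r → (∀ x, f x ≠ 0 → ∀ i, |x i| ≤ r) →
      ∀ (M : ℕ) [NeZero M], 2 ≤ M →
        |zeroModeMoment M f 4 - 3 * zeroModeMoment M f 2 ^ 2| ≤
          C * (⨆ x, |f x|) ^ 4 * r ^ γ / Real.log M ^ c * blockVariance M ^ 2)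
    (hB : ∀ (M : ℕ) [NeZero M], 0 < blockVariance M)
    (hC : ∀ (f : EuclideanSpace ℝ (Fin 3) → ℝ), Continuous f → HasCompactSupport f → f ≠ 0 →
      ∃ κ : ℝ, 0 < κ ∧ ∃ M₀ : ℕ, ∀ (M : ℕ) [NeZero M], M₀ ≤ M →
        κ * blockVariance M ≤ zeroModeMoment M f 2) :
    ∀ (f : EuclideanSpace ℝ (Fin 3) → ℝ), Continuous f → HasCompactSupport f → f ≠ 0 →
      ∀ ε : ℝ, 0 < ε → ∃ M₀ : ℕ, ∀ (M : ℕ) [NeZero M], M₀ ≤ M →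
        |zeroModeMoment M f 4 / zeroModeMoment M f 2 ^ 2 - 3| < ε := by
  intro f hf hcs hne ε hε
  obtain ⟨c, C, γ, hc, hC0, hAf⟩ := hA
  obtain ⟨κ, hκ, M₀, hCf⟩ := hC f hf hcs hne
  -- a box radius `r ≥ 1` with `f = 0` outside `[-r, r]³`
  obtain ⟨r, hr1, hr⟩ : ∃ r : ℝ, 1 ≤ r ∧ ∀ x, f x ≠ 0 → ∀ i, |x i| ≤ r := by
    obtain ⟨R, hR⟩ := (Metric.isBounded_iff_subset_closedBall (0 : EuclideanSpace ℝ (Fin 3))).1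
      hcs.isCompact.isBounded
    refine ⟨max R 1, le_max_right _ _, fun x hx i => ?_⟩
    have hx' : x ∈ tsupport f := subset_tsupport f (Function.mem_support.2 hx)
    have hxR : ‖x‖ ≤ R := by simpa [Metric.mem_closedBall, dist_zero_right] using hR hx'
    have hxi : |x i| ≤ ‖x‖ := by simpa using PiLp.norm_apply_le x i
    exact hxi.trans (hxR.trans (le_max_left _ _))
  have hr0 : 0 < r := lt_of_lt_of_le one_pos hr1
  have hrγ : 0 < r ^ γ := Real.rpow_pos_of_pos hr0 γ
  -- the constant `K := C ‖f‖_∞⁴ r^γ / κ²`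
  obtain ⟨K, hK⟩ : ∃ K : ℝ, K = C * (⨆ x, |f x|) ^ 4 * r ^ γ / κ ^ 2 := ⟨_, rfl⟩
  have hK0 : 0 ≤ K := by rw [hK]; positivity
  -- `(log M)^c → ∞`: eventually `K / ε < (log M)^c`
  have hev : ∀ᶠ M : ℕ in atTop, K / ε < Real.log (M : ℝ) ^ c := by
    have h1 : Tendsto (fun M : ℕ => Real.log (M : ℝ) ^ c) atTop atTop :=
      (tendsto_rpow_atTop hc).comp (Real.tendsto_log_atTop.comp tendsto_natCast_atTop_atTop)
    exact h1.eventually_gt_atTop (K / ε)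
  obtain ⟨M₁, hM₁⟩ := eventually_atTop.1 hev
  refine ⟨max (max M₀ M₁) 2, fun M _ hM => ?_⟩
  have hMM₀ : M₀ ≤ M := le_trans (le_trans (le_max_left _ _) (le_max_left _ _)) hM
  have hMM₁ : M₁ ≤ M := le_trans (le_trans (le_max_right _ _) (le_max_left _ _)) hM
  have hM2 : 2 ≤ M := le_trans (le_max_right _ _) hM
  -- the three inputs at this `M`
  have hV : 0 < blockVariance M := hB M
  have hE2 : κ * blockVariance M ≤ zeroModeMoment M f 2 := hCf M hMM₀
  have hW := hAf f hf r hr1 hr M hM2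
  have hlogc : K / ε < Real.log (M : ℝ) ^ c := hM₁ M hMM₁
  -- positivity of the variance and of `(log M)^c`
  have hE2pos : 0 < zeroModeMoment M f 2 := lt_of_lt_of_le (mul_pos hκ hV) hE2
  have hE2sq : 0 < zeroModeMoment M f 2 ^ 2 := pow_pos hE2pos 2
  have h1M : (1 : ℝ) < M := by exact_mod_cast (show 1 < M by omega)
  have hlc : 0 < Real.log (M : ℝ) ^ c := Real.rpow_pos_of_pos (Real.log_pos h1M) c
  -- kurtosis − 3 = Wick deviation / variance²
  have hratio : zeroModeMoment M f 4 / zeroModeMoment M f 2 ^ 2 - 3 =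
      (zeroModeMoment M f 4 - 3 * zeroModeMoment M f 2 ^ 2) / zeroModeMoment M f 2 ^ 2 := by
    field_simp
  rw [hratio, abs_div, abs_of_pos hE2sq, div_lt_iff₀ hE2sq]
  -- `(κ Σ_M)² ≤ ⟨T²⟩²`
  have hκV : (κ * blockVariance M) ^ 2 ≤ zeroModeMoment M f 2 ^ 2 :=
    pow_le_pow_left₀ (mul_nonneg hκ.le hV.le) hE2 2
  have hκ0 : κ ≠ 0 := hκ.ne'
  have hl0 : Real.log (M : ℝ) ^ c ≠ 0 := hlc.ne'
  have hnum : C * (⨆ x, |f x|) ^ 4 * r ^ γ / Real.log (M : ℝ) ^ c * blockVariance M ^ 2 =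
      K / Real.log (M : ℝ) ^ c * (κ * blockVariance M) ^ 2 := by
    rw [hK]
    field_simp
  have hKε : K / Real.log (M : ℝ) ^ c < ε := by
    rw [div_lt_iff₀ hlc, mul_comm]
    exact (div_lt_iff₀ hε).1 hlogc
  calc |zeroModeMoment M f 4 - 3 * zeroModeMoment M f 2 ^ 2|
      ≤ C * (⨆ x, |f x|) ^ 4 * r ^ γ / Real.log (M : ℝ) ^ c * blockVariance M ^ 2 := hW
    _ = K / Real.log (M : ℝ) ^ c * (κ * blockVariance M) ^ 2 := hnum
    _ ≤ K / Real.log (M : ℝ) ^ c * zeroModeMoment M f 2 ^ 2 :=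
        mul_le_mul_of_nonneg_left hκV (div_nonneg hK0 hlc.le)
    _ < ε * zeroModeMoment M f 2 ^ 2 := mul_lt_mul_of_pos_right hKε hE2sq

/-! ### Names for the stub statements (hypotheses of the skeleton theorem)

The native skeleton audit (`#h21_check_skeleton`, run by `ledger skeleton check`) admits a hypothesis
of the composing theorem only if its head constant is a registered obligation or is NAMED like a
declared stub; so each stub `stub_X` is mirrored by the alias `__Registered.stub_X : Prop :=
type_of% stub_X` (the Prop itself — it carries no `sorry`) and `SlabGaussianWindow_of` is stated over
the three aliases (device of the sibling birth skeletons, e.g. `Cruxes/BallSpecifiedFieldLimit/Lines/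
birth.lean`; the `__` namespace is an implementation detail, so audits resolve each `stub_…` to the
sorried theorem, not to its alias; the gate-reserved `@[stub]` attribute is not written by a planner).
Each alias is definitionally its statement (`stub_X : __Registered.stub_X` by `rfl` on types). -/

namespace __Registered

/-- Alias of the statement of the registered stub `stub_zeroModeWickDeviation`, keyed by its name. -/
abbrev stub_zeroModeWickDeviation : Prop := type_of% Birth.stub_zeroModeWickDeviation
/-- Alias of the statement of the registered stub `stub_blockVariance_pos`, keyed by its name. -/
abbrev stub_blockVariance_pos : Prop := type_of% Birth.stub_blockVariance_pos
/-- Alias of the statement of the registered stub `stub_zeroModeVarianceNondegenerate`, keyed by its name. -/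
abbrev stub_zeroModeVarianceNondegenerate : Prop := type_of% Birth.stub_zeroModeVarianceNondegenerate

end __Registered

/-! ### The skeleton theorem: the three stub statements give the crux BY NAME (no `sorry`) -/

/-- **`SlabGaussianWindow_of`** — the registered skeleton theorem: from the statements of the three
declared stubs (by name: `__Registered.stub_zeroModeWickDeviation`,
`__Registered.stub_blockVariance_pos`, `__Registered.stub_zeroModeVarianceNondegenerate`) to the route decl
`Theses.FourToThreeSlab.SlabGaussianWindow` BY NAME. Real proof (the composition
`slabGaussianWindow_of_hyps`; the abbreviations unfold definitionally to the crux's inlined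
vocabulary), axioms ⊆ {propext, Classical.choice, Quot.sound}. -/
theorem SlabGaussianWindow_of (hA : __Registered.stub_zeroModeWickDeviation)
    (hB : __Registered.stub_blockVariance_pos) (hC : __Registered.stub_zeroModeVarianceNondegenerate) :
    Summit.CriticalPhenomena.Ising3DConformalLimit.Theses.FourToThreeSlab.SlabGaussianWindow :=
  slabGaussianWindow_of_hyps hA hB hC

/-- The no-hypothesis instantiation: the crux BY NAME from the three `stub_*` constants (its axiom
closure is the whitelist `∪ {sorryAx via the stubs}` until the stubs are theorems; the day they are,
this term IS the crux proof). An `example`, so that `SlabGaussianWindow_of` stays the unique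
skeleton theorem of the file. -/
example : Summit.CriticalPhenomena.Ising3DConformalLimit.Theses.FourToThreeSlab.SlabGaussianWindow :=
  SlabGaussianWindow_of stub_zeroModeWickDeviation stub_blockVariance_pos
    stub_zeroModeVarianceNondegenerate

end Summit.CriticalPhenomena.Ising3DConformalLimit.Cruxes.SlabGaussianWindow.Birth

end
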